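import Mathlib
import Summits.Ventures.HodgeRepro.PeriodCloserC7Places
import Summits.Ventures.HodgeRepro.GaussSumStability

/-!
# PeriodCloserC7Stability — (E3) at a place of `S₃` from the stability of Gauss sums

Blind re-derivation cell `pub-hodge-repro`, seat night-2 (gen 1).  Target tree path
`lean/Summits/Ventures/HodgeRepro/PeriodCloserC7Stability.lean`.  Continues `PeriodCloserC7Places.lean`, whose
`E3At_of_stability` takes the stability identity `e_j = f_j · u` as a HYPOTHESIS; here that identity is PROVED on a
finite-ring model of the local characters from `GaussSumStability.lean`, so that (E3) at a place `v ∈ S₃` holds for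
every twist `ρ` of large enough conductor, as ROUTE-B §9.9 (d) / ROUTE.md §4 item 2 (9)(d) claim on a cite-only
input (Deligne 1973, not held).

**The model.**  Fix a non-split finite place `v` with local field `K_v`, ring of integers `𝒪`, prime `𝔭`,
uniformiser `ϖ`, residue cardinality `q`, an additive character `ψ` of conductor `ν` and an integer `c ≥ 1`.  A
character `ω` of `K_v^×` of conductor dividing `𝔭^c` is the pair (`LocalChar`)

* `ω.unit : MulChar R ℂ` — its restriction to `𝒪^×`, which factors through `R^× = (𝒪/𝔭^c)^×`, `R := 𝒪/𝔭^c`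
  (Mathlib's `MulChar` extends it by `0` off the units);
* `ω.piVal : ℂ` — its value at `ϖ`;

and the product of characters is the product of the pairs.  Kudla's printed ε-factor of a ramified character —
Prop. 3.8 (ii), `book:editornd-introduction-langlands-program` p0109:L3–L11 —

`ε(s, ω, ψ) = ω(ϖ^{ν+c}) q^{(1/2−s)(ν+c)} 𝔤(ω, ψ)`, `𝔤(ω, ψ) = q^{(ν+c)/2} ∫_{𝒪^×} ω^{−1}(y) ψ(ϖ^{−ν−c} y) dy` ((3.32), L33)

is, on the model, `eps κ n ω ψ̃ := ω.piVal ^ n * κ * gaussSum ω.unit⁻¹ ψ̃` with `n = ν + c`, `ψ̃(y) = ψ(ϖ^{−ν−c} y)`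
the induced additive character of `R`, and `κ = q^{(1/2−s)(ν+c)} · q^{(ν+c)/2} · vol(1 + 𝔭^c)` — a constant
depending on `(q, ν, c, s)` only, hence COMMON to every character of conductor `c` (the integrand of (3.32) is
constant on the cosets of `1 + 𝔭^c`, so the integral is `vol(1 + 𝔭^c)` times the finite sum).

**The theorem.**  For a twist `ρ` with `ρ(1 + z) = ψ̃(a z)` on `I = 𝔭^{⌈c/2⌉}/𝔭^c`, `a ∈ R^×` (conductor exactly `c`),
and a character `χ` trivial on the units `≡ 1` modulo the `ψ̃`-annihilator of `I` (`= 𝔭^{⌊c/2⌋}`, i.e. `c ≥ 2 a(χ)`):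

`eps κ n (χ * ρ) ψ̃ = cRho χ n a * eps κ n ρ ψ̃`, `cRho χ n a = χ(ϖ)^n · χ(a)^{−1} = χ(ϖ^{ν+c} a^{−1}) = χ(c_ρ)`

(`eps_mul_eq`) — the lead's «`ε(s, χρ, ψ) = χ(c_ρ) · ε(s, ρ, ψ)`, `c_ρ := ϖ^{ν+c} a_ρ^{−1}`» — and therefore, for
the four characters `χ′_j` of a face twisted by ONE `ρ`, under N2 (`χ′_0 χ′_1 = χ′_2 χ′_3`):

`ε(χ′_0 ρ) ε(χ′_1 ρ) = ε(χ′_2 ρ) ε(χ′_3 ρ)` (`eps_E3_of_N2`), which is `E3At` when the face's local signs at `v` are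
these values (`E3At_of_model`).  So (E3)_v costs nothing at any `v ∈ S₃` once the twist is chosen deep enough —
the conductor threshold is `c ≥ 2 · max_j a(χ′_j)`; the route's `c ≥ 2 · max_j c(χ′_j) + 2` is inside it.

**What this is not.**  The model is a faithful transcription of (3.32) for ONE place and ONE conductor; the
existence of the global conjugate-orthogonal `ρ` with prescribed local components (ROUTE-B §9.12 (c)), the
2-power-order precision at `v | 2`, and the identification of the face's local signs with the model's values are
outside it (hypotheses of `E3At_of_model`).  Nothing here says anything about the status of the Hodge conjecture
for CM abelian varieties, which is NOT proved.
-/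

set_option autoImplicit false

noncomputable section

open Finset

namespace Summit.Ventures.HodgeRepro.PeriodCloser

open GaussSumStability

/-! ### The finite-ring model of a local character of conductor dividing `𝔭^c` -/

/-- A character of `K_v^×` of conductor dividing `𝔭^c`, on the finite ring `R = 𝒪/𝔭^c`: its restriction to
the units (a `MulChar R ℂ`, `0` off the units) and its value at the uniformiser. -/
structure LocalChar (R : Type) [CommRing R] where
  /-- the restriction to `𝒪^×`, factoring through `(𝒪/𝔭^c)^× = R^×` -/
  unit : MulChar R ℂ
  /-- the value `ω(ϖ)` at the fixed uniformiser -/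
  piVal : ℂ

namespace LocalChar

variable {R : Type} [CommRing R]

/-- Characters multiply componentwise. -/
instance : Mul (LocalChar R) := ⟨fun χ ρ => ⟨χ.unit * ρ.unit, χ.piVal * ρ.piVal⟩⟩

/-- The unit part of a product. -/
@[simp] theorem mul_unit (χ ρ : LocalChar R) : (χ * ρ).unit = χ.unit * ρ.unit := rfl

/-- The uniformiser value of a product. -/
@[simp] theorem mul_piVal (χ ρ : LocalChar R) : (χ * ρ).piVal = χ.piVal * ρ.piVal := rfl

/-- **The value `χ(c_ρ)`**, `c_ρ = ϖ^{ν+c} a^{−1}`: `χ(ϖ)^{ν+c} · χ(a)^{−1}`. -/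
def cRho (χ : LocalChar R) (n : ℕ) (a : Rˣ) : ℂ := χ.piVal ^ n * (χ.unit (a : R))⁻¹

/-- `χ ↦ χ(c_ρ)` is multiplicative. -/
theorem cRho_mul (χ χ' : LocalChar R) (n : ℕ) (a : Rˣ) :
    cRho (χ * χ') n a = cRho χ n a * cRho χ' n a := by
  unfold cRho
  rw [mul_unit, mul_piVal, MulChar.coeToFun_mul, Pi.mul_apply, mul_pow, mul_inv]
  ring

/-- **The conductor hypothesis on `χ`** (`c ≥ 2 a(χ)` on `R = 𝒪/𝔭^c`): `χ` is trivial on the units `≡ 1` modulo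
the `ψ̃`-annihilator of `I`. -/
def Shallow (ψ : AddChar R ℂ) (I : Ideal R) (χ : LocalChar R) : Prop :=
  ∀ u : Rˣ, PsiAnn ψ I ((u : R) - 1) → χ.unit u = 1

/-- **The primitivity hypothesis on the twist `ρ`** (conductor exactly `c` on `R = 𝒪/𝔭^c`): `ρ(1 + z) = ψ̃(a z)`
on `I` with `a` a unit. -/
def Primitive (ψ : AddChar R ℂ) (I : Ideal R) (ρ : LocalChar R) (a : Rˣ) : Prop :=
  ∀ z ∈ I, ρ.unit (1 + z) = ψ (a * z)

/-- Shallowness is preserved by products. -/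
theorem Shallow.mul {ψ : AddChar R ℂ} {I : Ideal R} {χ χ' : LocalChar R} (h : Shallow ψ I χ)
    (h' : Shallow ψ I χ') : Shallow ψ I (χ * χ') := by
  intro u hu
  rw [mul_unit, MulChar.coeToFun_mul, Pi.mul_apply, h u hu, h' u hu, mul_one]

variable [Fintype R]

/-- **The Gauss sum of (3.32) on the model**: `∑_{y ∈ R^×} ω^{−1}(y) ψ̃(y)` (Kudla p0109:L33, up to the constant
`q^{(ν+c)/2} · vol(1 + 𝔭^c)` absorbed into `κ` below). -/
def gauss (ω : LocalChar R) (ψ : AddChar R ℂ) : ℂ := gaussSum ω.unit⁻¹ ψ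

/-- **Kudla's `ε(s, ω, ψ)` of Prop. 3.8 (ii) on the model** (p0109:L3–L11): `ω(ϖ)^{ν+c} · κ · 𝔤̃(ω, ψ̃)`, with
`n = ν + c` and `κ = κ(q, ν, c, s)` every factor independent of `ω`. -/
def eps (κ : ℂ) (n : ℕ) (ω : LocalChar R) (ψ : AddChar R ℂ) : ℂ := ω.piVal ^ n * κ * gauss ω ψ

/-- **Stability of the ε-factor** (ROUTE-B §9.9 (d) on Kudla (3.32), now a theorem of the model):
`ε(s, χρ, ψ) = χ(c_ρ) · ε(s, ρ, ψ)` for a primitive twist `ρ` and a shallow `χ`. -/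
theorem eps_mul_eq (κ : ℂ) (n : ℕ) (χ ρ : LocalChar R) (ψ : AddChar R ℂ) (I : Ideal R)
    (hI : ∀ z ∈ I, ∀ z' ∈ I, z * z' = 0) (a : Rˣ) (hρ : Primitive ψ I ρ a) (hχ : Shallow ψ I χ) :
    eps κ n (χ * ρ) ψ = cRho χ n a * eps κ n ρ ψ := by
  unfold eps gauss cRho
  rw [mul_unit, mul_piVal, gaussSum_inv_mul_eq χ.unit ρ.unit ψ I hI a hρ hχ, mul_pow]
  ring

/-- **(E3) at `v` for the four lines twisted by one `ρ`, from N2.**  If `χ′_0 χ′_1 = χ′_2 χ′_3` (N2 at `v`), all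
four `χ′_j` are shallow and `ρ` is primitive, then `ε(χ′_0 ρ) ε(χ′_1 ρ) = ε(χ′_2 ρ) ε(χ′_3 ρ)` — the algebra of
`E3At_of_stability` with its hypothesis `e_j = f_j · u` now supplied by `eps_mul_eq`. -/
theorem eps_E3_of_N2 (κ : ℂ) (n : ℕ) (χ' : Fin 4 → LocalChar R) (ρ : LocalChar R) (ψ : AddChar R ℂ)
    (I : Ideal R) (hI : ∀ z ∈ I, ∀ z' ∈ I, z * z' = 0) (a : Rˣ) (hρ : Primitive ψ I ρ a)
    (hχ : ∀ j, Shallow ψ I (χ' j)) (hN2 : χ' 0 * χ' 1 = χ' 2 * χ' 3) :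
    eps κ n (χ' 0 * ρ) ψ * eps κ n (χ' 1 * ρ) ψ = eps κ n (χ' 2 * ρ) ψ * eps κ n (χ' 3 * ρ) ψ :=
  E3At_of_stability (fun j => eps κ n (χ' j * ρ) ψ) (fun j => cRho (χ' j) n a) (eps κ n ρ ψ)
    (fun j => eps_mul_eq κ n (χ' j) ρ ψ I hI a hρ (hχ j))
    (by rw [← cRho_mul, ← cRho_mul, hN2])

end LocalChar

/-! ### The bridge to the chain's `E3At` -/

open NumberField

variable {L : Type} [Field L] [NumberField L] [IsCMField L]

/-- `E3At` from an identity of complex numbers: if the four local signs of the datum at `v` (elements of `ℤˣ`)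
are, as complex numbers, `e_0, …, e_3` with `e_0 e_1 = e_2 e_3`, then (E3) holds at `v`. -/
theorem E3At_of_complex (I : C7Face L) (v : I.Place) (d : I.Datum) (e : Fin 4 → ℂ)
    (he : ∀ j, ((I.localRootNumber v (I.chars d j) : ℤ) : ℂ) = e j) (h : e 0 * e 1 = e 2 * e 3) :
    E3At I v d := by
  unfold E3At
  apply Units.ext
  apply Int.cast_injective (α := ℂ)
  rw [Units.val_mul, Units.val_mul, Int.cast_mul, Int.cast_mul, he 0, he 1, he 2, he 3]
  exact h

/-- **(E3) at a place of `S₃` from the model.**  If the face's four local signs at `v` are the model's ε-factors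
of the four lines twisted by one primitive `ρ`, the lines are shallow (`c ≥ 2 · max_j a(χ′_j)`) and N2 holds at
`v`, then `E3At I v d` — the residual check (E3)_v of ROUTE.md §4 item 2 (9)(d) is discharged by the twist, on
the kernel, with no cite-only input. -/
theorem E3At_of_model {R : Type} [CommRing R] [Fintype R] (I : C7Face L) (v : I.Place) (d : I.Datum)
    (κ : ℂ) (n : ℕ) (χ' : Fin 4 → LocalChar R) (ρ : LocalChar R) (ψ : AddChar R ℂ) (J : Ideal R)
    (hJ : ∀ z ∈ J, ∀ z' ∈ J, z * z' = 0) (a : Rˣ) (hρ : LocalChar.Primitive ψ J ρ a)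
    (hχ : ∀ j, LocalChar.Shallow ψ J (χ' j)) (hN2 : χ' 0 * χ' 1 = χ' 2 * χ' 3)
    (he : ∀ j, ((I.localRootNumber v (I.chars d j) : ℤ) : ℂ) = LocalChar.eps κ n (χ' j * ρ) ψ) :
    E3At I v d :=
  E3At_of_complex I v d (fun j => LocalChar.eps κ n (χ' j * ρ) ψ) he
    (LocalChar.eps_E3_of_N2 κ n χ' ρ ψ J hJ a hρ hχ hN2)

end Summit.Ventures.HodgeRepro.PeriodCloser

end
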